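import Summits.AtomisticToContinuum.HydrodynamicLimit.Theorems.TwoClocksEquilibriumFastWindowLDBirthT12LogQuadratic
import Literature.Analysis.UnboundedOperators.LinearizedBoltzmannQuarticAbsorption
import HarnessLib

/-!
# Weighted absorption for Grad's integral equation with the log-quadratic weight, I: the off-ball step
# (helper `t12_abs_le_logWeight_of_fixedPoint` of the line `birth`, crux `TwoClocks.EquilibriumFastWindowLD`,
# stmt-AtomisticToContinuum-14440; infrastructure towards the registered analytic sub-goal
# `t12_logLinearPreimage_and_dipoleModulus`, sibling of `…BirthT12LogQuadratic`)

Second file of the "`2 + log`" a-priori bound for the orthogonal Chapman–Enskog pre-image of quadratic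
data. The weight is the log-quadratic `Φ(v) = P (1 + log P)`, `P = 1 + |v|²`, of `…BirthT12LogQuadratic`
(gain action `t12_lintegral_gain_fst_logWeight_le`, far-field margin `ν⁻¹ K₂ Φ ≤ Φ - P/4`,
`t12_gain_logWeight_margin`), TRUNCATED ADDITIVELY by the quartic weight of the tree
(`Literature.Analysis.UnboundedOperators.LinearizedBoltzmannQuarticWeightAction`): `W_N := Φ + P²/N`.
The a-priori quartic bound of `…BirthQuarticPreimage` makes `sup |ψ|/W_N` finite for each `N`; this file
proves the one-step improvement of a domination `|ψ| ≤ m W_N` at a far point, the sibling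
`…BirthT12LogQuadraticC` runs the `sSup` absorption (`…BirthT12Absorption`) and lets `N → ∞`.

* `lintegral_gain_fst_enorm_le_of_dom`, `abs_kernelAction_le_of_gain_le` — generic bookkeeping (any pair of
  measurable weights `W₁ + W₂/N` with first-gain bounds `Q₁, Q₂`; the kernel action from a first-gain
  bound, exchange symmetry `K₂'' = K₂'` and Cauchy–Schwarz for the partner loss), the additive-truncation
  form of the tree's `lintegral_gain_fst_enorm_le_of_quarticWeight` / `abs_kernelAction_le_of_quarticWeight`;
* **`t12_abs_le_logWeight_of_fixedPoint`** (registered helper) — THE OFF-BALL STEP: if `ψ` solves Grad's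
  integral equation `ν ψ = ∫∫ B (ψ' + ψ_*' - ψ_*) - g` at `y`, `|ψ| ≤ m (Φ + P²/N)` everywhere,
  `‖ψ‖_{L²(M)} ≤ B`, `|g(y)| ≤ C_g P(y)`, and `|y| ≥ 4`, `π|y| ≥ 144 σ(S²) m₅`,
  `(1 + log P)(1/|y|² + 2σ(S²)m₅/(π|y|)) ≤ 1/4`, then
  `|ψ(y)| ≤ m (Φ(y) - P/4 + (3/4) P²/N) + e₀ (B + C_g) P(y)`,
  `e₀ = σ(S²) m₂ (1/ν₀ + 1/π) + 1/π`: the log part contracts with the ABSOLUTE margin `P/4`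
  (`t12_gain_logWeight_margin`), the quartic part with the factor `3/4` (the tree's `17/24 + 1/24`), and
  the data + partner-loss terms are `O((B + C_g) P)` — dominated by the margin `m P/4` once `m ≫ B + C_g`,
  which is what the absorption of file C exploits (margin `(P + P²/N)/8 ≥ W_N/(16 (1 + log 4N²))`).

References: Grad 1963 §4; Caflisch, CMP 74 (1980); Guo, ARMA 197 (2010) §3 (weighted `L^∞` scheme);
Cercignani–Illner–Pulvirenti 1994 §7.2. Elementary given the tree's operator calculus; tagged folklore.
-/

noncomputable section

open MeasureTheory ProbabilityTheory Real Set Filter Metric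
open scoped ENNReal BigOperators InnerProductSpace

namespace Summit.AtomisticToContinuum.HydrodynamicLimit.Theorems.ClampedCorrectorBirth

open Literature.Analysis.FluidPDE Literature.MathematicalPhysics.KineticTheory
open Literature.Analysis.UnboundedOperators

/-! ### Generic bookkeeping: gain integral under a truncated domination, kernel action -/

/-- Measurability of a weighted gain integrand `(v_*, ω) ↦ ((v - v_*)·ω)₊ M(v_*) W(v')` for a measurable
weight `W`. [folklore] -/
theorem measurable_kernel_mul_globalMaxwellian_mul_comp_collide {W : EuclideanSpace ℝ (Fin 3) → ℝ}
    (hW : Measurable W) (v : EuclideanSpace ℝ (Fin 3)) :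
    Measurable fun p : EuclideanSpace ℝ (Fin 3) × sphere (0 : EuclideanSpace ℝ (Fin 3)) 1 =>
      ENNReal.ofReal (hardSphereKernel (v, p.1) p.2 * globalMaxwellian p.1) *
        ENNReal.ofReal (W (collide p.2 (v, p.1)).1) := by
  have h1 : Continuous fun p : EuclideanSpace ℝ (Fin 3) × sphere (0 : EuclideanSpace ℝ (Fin 3)) 1 =>
      hardSphereKernel (v, p.1) p.2 * globalMaxwellian p.1 := by
    refine Continuous.mul ?_ (continuous_globalMaxwellian.comp continuous_fst)
    unfold hardSphereKernel; fun_prop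
  have h2 : Continuous fun p : EuclideanSpace ℝ (Fin 3) × sphere (0 : EuclideanSpace ℝ (Fin 3)) 1 =>
      (collide p.2 (v, p.1)).1 := by
    unfold collide; fun_prop
  exact h1.measurable.ennreal_ofReal.mul (hW.comp h2.measurable).ennreal_ofReal

/-- **The gain integral under a domination by a truncated weight `W₁ + W₂/N`.** If
`|ψ| ≤ m (W₁ + W₂/N)` with measurable weights `W₁, W₂ ≥ 0` whose first gain integrals at `v` are
bounded by `Q₁`, `Q₂`, then `∫∫ ((v - v_*)·ω)₊ M(v_*) |ψ(v')| ≤ m (Q₁ + Q₂/N)` (positivity and linearity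
of the gain operator; the additive truncation of `…T12Absorption`). [folklore] -/
theorem lintegral_gain_fst_enorm_le_of_dom {ψ W₁ W₂ : EuclideanSpace ℝ (Fin 3) → ℝ}
    (hW₁ : Measurable W₁) (hW₂ : Measurable W₂) {m N Q₁ Q₂ : ℝ}
    (hm : 0 ≤ m) (hN : 0 < N) (hQ₁ : 0 ≤ Q₁) (hQ₂ : 0 ≤ Q₂) (hdom : ∀ y, |ψ y| ≤ m * (W₁ y + W₂ y / N))
    {v : EuclideanSpace ℝ (Fin 3)}
    (h₁ : ∫⁻ w, ∫⁻ ω, ENNReal.ofReal (hardSphereKernel (v, w) ω * globalMaxwellian w) *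
        ENNReal.ofReal (W₁ (collide ω (v, w)).1) ∂sphereMeasure ≤ ENNReal.ofReal Q₁)
    (h₂ : ∫⁻ w, ∫⁻ ω, ENNReal.ofReal (hardSphereKernel (v, w) ω * globalMaxwellian w) *
        ENNReal.ofReal (W₂ (collide ω (v, w)).1) ∂sphereMeasure ≤ ENNReal.ofReal Q₂) :
    ∫⁻ w, ∫⁻ ω, ENNReal.ofReal (hardSphereKernel (v, w) ω * globalMaxwellian w) *
        ‖ψ (collide ω (v, w)).1‖ₑ ∂sphereMeasure ≤ ENNReal.ofReal (m * (Q₁ + Q₂ / N)) := by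
  set F₁ : EuclideanSpace ℝ (Fin 3) → sphere (0 : EuclideanSpace ℝ (Fin 3)) 1 → ℝ≥0∞ := fun w ω =>
    ENNReal.ofReal (hardSphereKernel (v, w) ω * globalMaxwellian w) * ENNReal.ofReal (W₁ (collide ω (v, w)).1)
    with hF₁
  set F₂ : EuclideanSpace ℝ (Fin 3) → sphere (0 : EuclideanSpace ℝ (Fin 3)) 1 → ℝ≥0∞ := fun w ω =>
    ENNReal.ofReal (hardSphereKernel (v, w) ω * globalMaxwellian w) * ENNReal.ofReal (W₂ (collide ω (v, w)).1)
    with hF₂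
  have hF₁m : Measurable (Function.uncurry F₁) := measurable_kernel_mul_globalMaxwellian_mul_comp_collide hW₁ v
  have hF₂m : Measurable (Function.uncurry F₂) := measurable_kernel_mul_globalMaxwellian_mul_comp_collide hW₂ v
  -- pointwise domination
  have hpt : ∀ w ω, ENNReal.ofReal (hardSphereKernel (v, w) ω * globalMaxwellian w) *
      ‖ψ (collide ω (v, w)).1‖ₑ ≤ ENNReal.ofReal m * (F₁ w ω + ENNReal.ofReal N⁻¹ * F₂ w ω) := by
    intro w ω
    set y := (collide ω (v, w)).1 with hy
    have h1 : ‖ψ y‖ₑ ≤ ENNReal.ofReal m * (ENNReal.ofReal (W₁ y) + ENNReal.ofReal N⁻¹ * ENNReal.ofReal (W₂ y)) := by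
      rw [Real.enorm_eq_ofReal_abs]
      refine (ENNReal.ofReal_le_ofReal (hdom y)).trans ?_
      rw [ENNReal.ofReal_mul hm, ← ENNReal.ofReal_mul (inv_nonneg.2 hN.le)]
      refine mul_le_mul' le_rfl (ENNReal.ofReal_add_le.trans (add_le_add le_rfl (ENNReal.ofReal_le_ofReal ?_)))
      rw [div_eq_inv_mul]
    calc ENNReal.ofReal (hardSphereKernel (v, w) ω * globalMaxwellian w) * ‖ψ y‖ₑ
        ≤ ENNReal.ofReal (hardSphereKernel (v, w) ω * globalMaxwellian w) *
            (ENNReal.ofReal m * (ENNReal.ofReal (W₁ y) + ENNReal.ofReal N⁻¹ * ENNReal.ofReal (W₂ y))) :=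
          mul_le_mul' le_rfl h1
      _ = ENNReal.ofReal m * (F₁ w ω + ENNReal.ofReal N⁻¹ * F₂ w ω) := by rw [hF₁, hF₂]; ring
  have hinner : ∀ w, ∫⁻ ω, ENNReal.ofReal m * (F₁ w ω + ENNReal.ofReal N⁻¹ * F₂ w ω) ∂sphereMeasure =
      ENNReal.ofReal m * ((∫⁻ ω, F₁ w ω ∂sphereMeasure) + ENNReal.ofReal N⁻¹ * ∫⁻ ω, F₂ w ω ∂sphereMeasure) := by
    intro w
    have hm1 : Measurable fun ω => F₁ w ω := hF₁m.of_uncurry_left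
    rw [lintegral_const_mul' _ _ ENNReal.ofReal_ne_top, lintegral_add_left hm1,
      lintegral_const_mul' _ _ ENNReal.ofReal_ne_top]
  have hout : ∫⁻ w, ENNReal.ofReal m * ((∫⁻ ω, F₁ w ω ∂sphereMeasure) +
      ENNReal.ofReal N⁻¹ * ∫⁻ ω, F₂ w ω ∂sphereMeasure) =
      ENNReal.ofReal m * ((∫⁻ w, ∫⁻ ω, F₁ w ω ∂sphereMeasure) +
        ENNReal.ofReal N⁻¹ * ∫⁻ w, ∫⁻ ω, F₂ w ω ∂sphereMeasure) := by
    have hm1 : Measurable fun w => ∫⁻ ω, F₁ w ω ∂(sphereMeasure : Measure (sphere (0 : EuclideanSpace ℝ (Fin 3)) 1)) :=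
      hF₁m.lintegral_prod_right'
    rw [lintegral_const_mul' _ _ ENNReal.ofReal_ne_top, lintegral_add_left hm1,
      lintegral_const_mul' _ _ ENNReal.ofReal_ne_top]
  calc ∫⁻ w, ∫⁻ ω, ENNReal.ofReal (hardSphereKernel (v, w) ω * globalMaxwellian w) *
          ‖ψ (collide ω (v, w)).1‖ₑ ∂sphereMeasure
      ≤ ∫⁻ w, ∫⁻ ω, ENNReal.ofReal m * (F₁ w ω + ENNReal.ofReal N⁻¹ * F₂ w ω) ∂sphereMeasure :=
        lintegral_mono fun w => lintegral_mono fun ω => hpt w ω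
    _ = ENNReal.ofReal m * ((∫⁻ w, ∫⁻ ω, F₁ w ω ∂sphereMeasure) +
          ENNReal.ofReal N⁻¹ * ∫⁻ w, ∫⁻ ω, F₂ w ω ∂sphereMeasure) := by rw [lintegral_congr hinner, hout]
    _ ≤ ENNReal.ofReal m * (ENNReal.ofReal Q₁ + ENNReal.ofReal N⁻¹ * ENNReal.ofReal Q₂) :=
        mul_le_mul' le_rfl (add_le_add h₁ (mul_le_mul' le_rfl h₂))
    _ = ENNReal.ofReal (m * (Q₁ + Q₂ / N)) := by
        rw [← ENNReal.ofReal_mul (inv_nonneg.2 hN.le), ← ENNReal.ofReal_add hQ₁ (mul_nonneg (inv_nonneg.2 hN.le) hQ₂),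
          ← ENNReal.ofReal_mul hm, inv_mul_eq_div]

/-- **The kernel action from a bound on the first gain integral** (`ℝ³`): if
`∫∫ ((v - v_*)·ω)₊ M(v_*) |ψ(v')| ≤ X` and `‖ψ‖_{L²(M)} ≤ B`, then
`|∫∫ B (ψ' + ψ_*' - ψ_*) dω dM_*| ≤ 2X + σ(S²)(1 + |v|) m₂ B` (domination by the three absolute pieces,
exchange symmetry `K₂'' = K₂'`, Cauchy–Schwarz for the loss piece). [folklore] -/
theorem abs_kernelAction_le_of_gain_le {ψ : EuclideanSpace ℝ (Fin 3) → ℝ} (hψm : Measurable ψ)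
    (hψ2 : MemLp ψ 2 (stdGaussian (EuclideanSpace ℝ (Fin 3)))) {X B : ℝ} (hX0 : 0 ≤ X)
    (hB : (eLpNorm ψ 2 (stdGaussian (EuclideanSpace ℝ (Fin 3)))).toReal ≤ B) {v : EuclideanSpace ℝ (Fin 3)}
    (hI : ∫⁻ w, ∫⁻ ω, ENNReal.ofReal (hardSphereKernel (v, w) ω * globalMaxwellian w) *
        ‖ψ (collide ω (v, w)).1‖ₑ ∂sphereMeasure ≤ ENNReal.ofReal X) :
    |∫ w, ∫ ω, hardSphereKernel (v, w) ω * (ψ (collide ω (v, w)).1 + ψ (collide ω (v, w)).2 - ψ w)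
        ∂sphereMeasure ∂stdGaussian (EuclideanSpace ℝ (Fin 3))| ≤
      2 * X + (sphereMeasure : Measure (sphere (0 : EuclideanSpace ℝ (Fin 3)) 1)).real univ * (1 + ‖v‖) *
        ((((∫⁻ w, ENNReal.ofReal ((1 + ‖w‖) ^ 2) ∂stdGaussian (EuclideanSpace ℝ (Fin 3))) ^ (1 / 2 : ℝ)).toReal) * B) := by
  haveI := isFiniteMeasure_sphereMeasure (E := EuclideanSpace ℝ (Fin 3))
  set M2 : ℝ≥0∞ := (∫⁻ w, ENNReal.ofReal ((1 + ‖w‖) ^ 2) ∂stdGaussian (EuclideanSpace ℝ (Fin 3))) ^ (1 / 2 : ℝ)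
    with hM2
  have hM2t : M2 ≠ ∞ := by
    refine ENNReal.rpow_ne_top_of_nonneg (by norm_num) ?_
    exact ((integrable_one_add_norm_pow_stdGaussian (E := EuclideanSpace ℝ (Fin 3)) 2).lintegral_lt_top).ne
  set S : ℝ := (sphereMeasure : Measure (sphere (0 : EuclideanSpace ℝ (Fin 3)) 1)).real univ with hS
  set Nψ : ℝ≥0∞ := eLpNorm ψ 2 (stdGaussian (EuclideanSpace ℝ (Fin 3))) with hNψ
  have hNt : Nψ ≠ ∞ := hψ2.eLpNorm_ne_top
  have hc : ∀ i : Fin 2, Measurable fun p : EuclideanSpace ℝ (Fin 3) × sphere (0 : EuclideanSpace ℝ (Fin 3)) 1 =>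
      if i = 0 then (collide p.2 (v, p.1)).1 else (collide p.2 (v, p.1)).2 := by
    intro i
    split_ifs
    · exact (by unfold collide; fun_prop : Continuous fun p : EuclideanSpace ℝ (Fin 3) ×
        sphere (0 : EuclideanSpace ℝ (Fin 3)) 1 => (collide p.2 (v, p.1)).1).measurable
    · exact (by unfold collide; fun_prop : Continuous fun p : EuclideanSpace ℝ (Fin 3) ×
        sphere (0 : EuclideanSpace ℝ (Fin 3)) 1 => (collide p.2 (v, p.1)).2).measurable
  have I1 : ∫⁻ w, ∫⁻ ω, ENNReal.ofReal (hardSphereKernel (v, w) ω) * ‖ψ (collide ω (v, w)).1‖ₑ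
      ∂sphereMeasure ∂stdGaussian (EuclideanSpace ℝ (Fin 3)) ≤ ENNReal.ofReal X := by
    rw [lintegral_stdGaussian_kernel_eq_volume (U := fun p => ‖ψ (collide p.2 (v, p.1)).1‖ₑ)
      ((hψm.comp (hc 0)).enorm) v]
    exact hI
  have I2 : ∫⁻ w, ∫⁻ ω, ENNReal.ofReal (hardSphereKernel (v, w) ω) * ‖ψ (collide ω (v, w)).2‖ₑ
      ∂sphereMeasure ∂stdGaussian (EuclideanSpace ℝ (Fin 3)) ≤ ENNReal.ofReal X := by
    rw [lintegral_stdGaussian_kernel_eq_volume (U := fun p => ‖ψ (collide p.2 (v, p.1)).2‖ₑ)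
      ((hψm.comp (hc 1)).enorm) v,
      lintegral_lintegral_hardSphere_gain_exchange v globalMaxwellian volume hψm.enorm]
    exact hI
  have I3 : ∫⁻ w, ∫⁻ ω, ENNReal.ofReal (hardSphereKernel (v, w) ω) * ‖ψ w‖ₑ
      ∂sphereMeasure ∂stdGaussian (EuclideanSpace ℝ (Fin 3)) ≤ ENNReal.ofReal (S * (1 + ‖v‖)) * (M2 * Nψ) :=
    lintegral_loss_enorm_le hψm v
  have htot := (enorm_kernelAction_le_add hψm v).trans (add_le_add (add_le_add I1 I2) I3)
  have hne3 : ENNReal.ofReal (S * (1 + ‖v‖)) * (M2 * Nψ) ≠ ∞ :=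
    ENNReal.mul_ne_top ENNReal.ofReal_ne_top (ENNReal.mul_ne_top hM2t hNt)
  have hfin : ENNReal.ofReal X + ENNReal.ofReal X + ENNReal.ofReal (S * (1 + ‖v‖)) * (M2 * Nψ) ≠ ∞ :=
    ENNReal.add_ne_top.2 ⟨ENNReal.add_ne_top.2 ⟨ENNReal.ofReal_ne_top, ENNReal.ofReal_ne_top⟩, hne3⟩
  rw [← ENNReal.toReal_ofReal (abs_nonneg _), ← Real.enorm_eq_ofReal_abs]
  refine (ENNReal.toReal_mono hfin htot).trans ?_
  rw [ENNReal.toReal_add (ENNReal.add_ne_top.2 ⟨ENNReal.ofReal_ne_top, ENNReal.ofReal_ne_top⟩) hne3,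
    ENNReal.toReal_add ENNReal.ofReal_ne_top ENNReal.ofReal_ne_top, ENNReal.toReal_ofReal hX0,
    ENNReal.toReal_mul, ENNReal.toReal_mul, ENNReal.toReal_ofReal (by positivity)]
  have h1 : M2.toReal * Nψ.toReal ≤ M2.toReal * B := mul_le_mul_of_nonneg_left hB ENNReal.toReal_nonneg
  have h2 := mul_le_mul_of_nonneg_left h1 (by positivity : 0 ≤ S * (1 + ‖v‖))
  linarith

/-! ### The off-ball step for the truncated log-quadratic weight -/

/-- **Registered helper `t12_abs_le_logWeight_of_fixedPoint` — off-ball step of the weighted sup-norm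
scheme for the log-quadratic weight truncated by the quartic one.** Let `ψ` be measurable, in `L²(M)`
with `‖ψ‖_{L²(M)} ≤ B`, dominated as `|ψ(x)| ≤ m (Φ(x) + P(x)²/N)` (`Φ = P (1 + log P)`, `P = 1 + |x|²`,
`N > 0`, `m ≥ 0`), and solve Grad's integral equation `ν ψ = ∫∫ B (ψ' + ψ_*' - ψ_*) dω dM_* - g` at a point
`y` with `|g(y)| ≤ C_g P(y)`, `ν(y) ≥ ν₀ > 0`. If `|y| ≥ 4`, `π|y| ≥ 144 σ(S²) m₅` and
`(1 + log P(y))(1/|y|² + 2 σ(S²) m₅/(π|y|)) ≤ 1/4` (`m₅ = ∫ (1 + |w|)⁵ dM`), then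
`|ψ(y)| ≤ m (Φ(y) - P(y)/4 + (3/4) P(y)²/N) + (σ(S²) m₂ (1/ν₀ + 1/π) + 1/π)(B + C_g) P(y)`,
`m₂ = (∫ (1 + |w|)² dM)^{1/2}`. Ingredients: the first-gain bounds `t12_lintegral_gain_fst_logWeight_le` and
`lintegral_gain_fst_quarticWeight_le`, the margin `t12_gain_logWeight_margin`, the quartic contraction
`2 Q₄ ≤ (3/4) P² ν` (`16 P ≤ 17 |y|²`, `π|y| ≥ 144 σ m₅`), `ν ≥ π|y|`, `ν ≥ ν₀`, Cauchy–Schwarz for the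
partner loss. Grad 1963 / Guo 2010 scheme at the critical power, cf. the tree's
`abs_le_threeQuarter_weight_add_of_fixedPoint`. [folklore] -/
theorem t12_abs_le_logWeight_of_fixedPoint : ∀ (ψ g : EuclideanSpace ℝ (Fin 3) → ℝ) (N m B Cg ν₀ : ℝ) (y : EuclideanSpace ℝ (Fin 3)), Measurable ψ → MeasureTheory.MemLp ψ 2 (ProbabilityTheory.stdGaussian (EuclideanSpace ℝ (Fin 3))) → 0 < N → 0 ≤ m → 0 ≤ B → 0 ≤ Cg → 0 < ν₀ → (∀ x, |ψ x| ≤ m * ((1 + ‖x‖ ^ 2) * (1 + Real.log (1 + ‖x‖ ^ 2)) + (1 + ‖x‖ ^ 2) ^ 2 / N)) → (MeasureTheory.eLpNorm ψ 2 (ProbabilityTheory.stdGaussian (EuclideanSpace ℝ (Fin 3)))).toReal ≤ B → 4 ≤ ‖y‖ → 144 * ((Literature.MathematicalPhysics.KineticTheory.sphereMeasure : MeasureTheory.Measure (Metric.sphere (0 : EuclideanSpace ℝ (Fin 3)) 1)).real Set.univ * ∫ w, (1 + ‖w‖) ^ 5 ∂ProbabilityTheory.stdGaussian (EuclideanSpace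 ℝ (Fin 3))) ≤ Real.pi * ‖y‖ → (1 + Real.log (1 + ‖y‖ ^ 2)) * (1 / ‖y‖ ^ 2 + 2 * ((Literature.MathematicalPhysics.KineticTheory.sphereMeasure : MeasureTheory.Measure (Metric.sphere (0 : EuclideanSpace ℝ (Fin 3)) 1)).real Set.univ * ∫ w, (1 + ‖w‖) ^ 5 ∂ProbabilityTheory.stdGaussian (EuclideanSpace ℝ (Fin 3))) / (Real.pi * ‖y‖)) ≤ 1 / 4 → ν₀ ≤ Literature.Analysis.UnboundedOperators.collisionFrequency y → |g y| ≤ Cg * (1 + ‖y‖ ^ 2) → Literature.Analysis.UnboundedOperators.collisionFrequency y * ψ y = (∫ w, ∫ ω, Literature.MathematicalPhysics.KineticTheory.hardSphereKernel (y, w) ω * (ψ (Literature.MathematicalPhysics.KineticTheory.collide ω (y, w)).1 + ψ (Literature.MathematicalPhysics.KineticTheory.collide ω (y, w)).2 - ψ w) ∂Literature.MathematicalPhysics.KineticTheory.sphereMeasure ∂ProbabilityTheory.stdGaussian (EuclideanSpace ℝ (Fin 3))) - g y → |ψ y| ≤ m * ((1 + ‖y‖ ^ 2) * (1 + Real.log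 (1 + ‖y‖ ^ 2)) - (1 + ‖y‖ ^ 2) / 4 + 3 / 4 * ((1 + ‖y‖ ^ 2) ^ 2 / N)) + (((Literature.MathematicalPhysics.KineticTheory.sphereMeasure : MeasureTheory.Measure (Metric.sphere (0 : EuclideanSpace ℝ (Fin 3)) 1)).real Set.univ * ((∫⁻ w, ENNReal.ofReal ((1 + ‖w‖) ^ 2) ∂ProbabilityTheory.stdGaussian (EuclideanSpace ℝ (Fin 3))) ^ (1 / 2 : ℝ)).toReal) * (1 / ν₀ + 1 / Real.pi) + 1 / Real.pi) * (B + Cg) * (1 + ‖y‖ ^ 2) := by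
  intro ψ g N m B Cg ν₀ y hψm hψ2 hN hm hB0 hCg hν₀ hdom hB hy1 hy2 hy3 hνy hgb hfix
  have hyn : 0 < ‖y‖ := by linarith
  have hy0 : y ≠ 0 := norm_pos_iff.1 hyn
  have hνπ : Real.pi * ‖y‖ ≤ collisionFrequency y := pi_mul_norm_le_collisionFrequency y
  have hν : 0 < collisionFrequency y := hν₀.trans_le hνy
  -- the two gain bounds and the margin (before abbreviating)
  have h₁ := t12_lintegral_gain_fst_logWeight_le y hy0
  have h₂ := lintegral_gain_fst_quarticWeight_le hy0
  have hmar := t12_gain_logWeight_margin y hy0 hy3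
  set S : ℝ := (sphereMeasure : Measure (sphere (0 : EuclideanSpace ℝ (Fin 3)) 1)).real univ with hS
  set m₂ : ℝ := (((∫⁻ w, ENNReal.ofReal ((1 + ‖w‖) ^ 2) ∂stdGaussian (EuclideanSpace ℝ (Fin 3))) ^
    (1 / 2 : ℝ))).toReal with hm₂
  set m₅ : ℝ := ∫ w, (1 + ‖w‖) ^ 5 ∂stdGaussian (EuclideanSpace ℝ (Fin 3)) with hm₅
  set P : ℝ := 1 + ‖y‖ ^ 2 with hP
  set L : ℝ := 1 + Real.log P with hL
  set QΦ : ℝ := Real.pi / ‖y‖ * (P ^ 2 / 4 + P ^ 2 / 2 * Real.log P - 1 / 4) + S * m₅ * (P * L) with hQΦ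
  set Q₄ : ℝ := Real.pi * P ^ 3 / (3 * ‖y‖) + 3 * S * m₅ * P ^ 2 with hQ₄
  have hS0 : 0 ≤ S := measureReal_nonneg
  have hm₂0 : 0 ≤ m₂ := ENNReal.toReal_nonneg
  have hm₅0 : 0 ≤ m₅ := integral_nonneg fun w => by positivity
  clear_value S m₂ m₅ P L QΦ Q₄
  have hP1 : 1 ≤ P := by rw [hP]; nlinarith
  have hP0 : 0 < P := by linarith
  have hL1 : 1 ≤ L := by rw [hL]; linarith [Real.log_nonneg hP1]
  have hQΦ0 : 0 ≤ QΦ := by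
    have h1 : 0 ≤ P ^ 2 / 4 + P ^ 2 / 2 * Real.log P - 1 / 4 := by nlinarith [Real.log_nonneg hP1, sq_nonneg P]
    rw [hQΦ]
    exact add_nonneg (mul_nonneg (div_nonneg Real.pi_pos.le hyn.le) h1)
      (mul_nonneg (mul_nonneg hS0 hm₅0) (mul_nonneg hP0.le (by linarith)))
  have hQ₄0 : 0 ≤ Q₄ := by rw [hQ₄]; positivity
  have hW₁m : Measurable fun x : EuclideanSpace ℝ (Fin 3) => (1 + ‖x‖ ^ 2) * (1 + Real.log (1 + ‖x‖ ^ 2)) := by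
    have h : Measurable fun x : EuclideanSpace ℝ (Fin 3) => 1 + ‖x‖ ^ 2 := by fun_prop
    exact h.mul (measurable_const.add (Real.measurable_log.comp h))
  have hW₂m : Measurable fun x : EuclideanSpace ℝ (Fin 3) => (1 + ‖x‖ ^ 2) ^ 2 := by fun_prop
  have hI := lintegral_gain_fst_enorm_le_of_dom (ψ := ψ) hW₁m hW₂m hm hN hQΦ0 hQ₄0 hdom h₁ h₂
  have hKψ := abs_kernelAction_le_of_gain_le hψm hψ2 (by positivity) hB hI
  rw [← hS, ← hm₂] at hKψ
  clear h₁ h₂ hI hW₁m hW₂m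
  set Kψ := ∫ w, ∫ ω, hardSphereKernel (y, w) ω * (ψ (collide ω (y, w)).1 + ψ (collide ω (y, w)).2 - ψ w)
    ∂sphereMeasure ∂stdGaussian (EuclideanSpace ℝ (Fin 3)) with hKψdef
  -- `|ψ y| ν ≤ |Kψ| + Cg P`
  have hψy : |ψ y| * collisionFrequency y ≤ |Kψ| + Cg * P := by
    have : ψ y * collisionFrequency y = Kψ - g y := by rw [mul_comm]; exact hfix
    rw [← abs_of_pos hν, ← abs_mul, this]
    exact (abs_sub _ _).trans (add_le_add le_rfl hgb)
  -- the log-weight gain term, with its margin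
  have hg1 : 2 * (m * QΦ) ≤ m * (P * L - P / 4) * collisionFrequency y := by
    have := mul_le_mul_of_nonneg_left hmar hm
    linarith [this]
  -- the quartic gain term: `2 Q₄ ≤ (3/4) P² ν`
  have hg2 : 2 * (m * (Q₄ / N)) ≤ 3 / 4 * m * (P ^ 2 / N) * collisionFrequency y := by
    have h16 : 16 * P ≤ 17 * ‖y‖ ^ 2 := by rw [hP]; nlinarith
    have e1 : 2 * (Real.pi * P ^ 3 / (3 * ‖y‖)) ≤ 17 / 24 * P ^ 2 * (Real.pi * ‖y‖) := by
      rw [show 2 * (Real.pi * P ^ 3 / (3 * ‖y‖)) = P ^ 2 * (2 * Real.pi * P / (3 * ‖y‖)) by field_simp]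
      rw [show 17 / 24 * P ^ 2 * (Real.pi * ‖y‖) = P ^ 2 * (17 / 24 * (Real.pi * ‖y‖)) by ring]
      refine mul_le_mul_of_nonneg_left ?_ (sq_nonneg _)
      rw [div_le_iff₀ (by positivity)]
      linarith [mul_le_mul_of_nonneg_left h16 Real.pi_pos.le]
    have e2 : 2 * (3 * S * m₅ * P ^ 2) ≤ 1 / 24 * P ^ 2 * (Real.pi * ‖y‖) := by
      linarith [mul_le_mul_of_nonneg_left hy2 (sq_nonneg P)]
    have e3 : 2 * Q₄ ≤ 3 / 4 * P ^ 2 * collisionFrequency y := by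
      have : 3 / 4 * P ^ 2 * (Real.pi * ‖y‖) ≤ 3 / 4 * P ^ 2 * collisionFrequency y :=
        mul_le_mul_of_nonneg_left hνπ (by positivity)
      rw [hQ₄]; linarith
    have := mul_le_mul_of_nonneg_left e3 (div_nonneg hm hN.le)
    calc 2 * (m * (Q₄ / N)) = m / N * (2 * Q₄) := by field_simp
      _ ≤ m / N * (3 / 4 * P ^ 2 * collisionFrequency y) := this
      _ = 3 / 4 * m * (P ^ 2 / N) * collisionFrequency y := by field_simp
  -- loss and source parts
  have h1 : 1 ≤ collisionFrequency y / ν₀ := by rw [le_div_iff₀ hν₀, one_mul]; exact hνy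
  have h2 : ‖y‖ ≤ collisionFrequency y / Real.pi := by rw [le_div_iff₀ Real.pi_pos, mul_comm]; exact hνπ
  have hrest : S * (1 + ‖y‖) * (m₂ * B) + Cg * P ≤
      (S * m₂ * (1 / ν₀ + 1 / Real.pi) + 1 / Real.pi) * (B + Cg) * P * collisionFrequency y := by
    have hq0 : 0 ≤ collisionFrequency y / ν₀ + collisionFrequency y / Real.pi :=
      add_nonneg (div_nonneg hν.le hν₀.le) (div_nonneg hν.le Real.pi_pos.le)
    have hSmB : 0 ≤ S * m₂ * B := mul_nonneg (mul_nonneg hS0 hm₂0) hB0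
    have h1π : 1 ≤ collisionFrequency y / Real.pi := by
      rw [le_div_iff₀ Real.pi_pos, one_mul]
      linarith [mul_le_mul_of_nonneg_left (show (1:ℝ) ≤ ‖y‖ by linarith) Real.pi_pos.le]
    have i1 : S * (1 + ‖y‖) * (m₂ * B) ≤
        S * m₂ * B * (collisionFrequency y / ν₀ + collisionFrequency y / Real.pi) * P := by
      rw [show S * (1 + ‖y‖) * (m₂ * B) = S * m₂ * B * (1 + ‖y‖) by ring]
      exact (mul_le_mul_of_nonneg_left (add_le_add h1 h2) hSmB).trans
        (le_mul_of_one_le_right (mul_nonneg hSmB hq0) hP1)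
    have i2 : Cg * P ≤ Cg * P * (collisionFrequency y / Real.pi) :=
      le_mul_of_one_le_right (mul_nonneg hCg hP0.le) h1π
    have i3 : 0 ≤ S * m₂ * Cg * (collisionFrequency y / ν₀ + collisionFrequency y / Real.pi) * P :=
      mul_nonneg (mul_nonneg (mul_nonneg (mul_nonneg hS0 hm₂0) hCg) hq0) hP0.le
    have i4 : 0 ≤ B * P * (collisionFrequency y / Real.pi) :=
      mul_nonneg (mul_nonneg hB0 hP0.le) (div_nonneg hν.le Real.pi_pos.le)
    have e : (S * m₂ * (1 / ν₀ + 1 / Real.pi) + 1 / Real.pi) * (B + Cg) * P * collisionFrequency y =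
        S * m₂ * B * (collisionFrequency y / ν₀ + collisionFrequency y / Real.pi) * P +
          S * m₂ * Cg * (collisionFrequency y / ν₀ + collisionFrequency y / Real.pi) * P +
          B * P * (collisionFrequency y / Real.pi) + Cg * P * (collisionFrequency y / Real.pi) := by
      field_simp
      ring
    rw [e]
    linarith
  -- combine and divide by `ν`
  have htot : |ψ y| * collisionFrequency y ≤
      (m * (P * L - P / 4 + 3 / 4 * (P ^ 2 / N)) +
        (S * m₂ * (1 / ν₀ + 1 / Real.pi) + 1 / Real.pi) * (B + Cg) * P) * collisionFrequency y := by
    have e : (m * (P * L - P / 4 + 3 / 4 * (P ^ 2 / N)) +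
        (S * m₂ * (1 / ν₀ + 1 / Real.pi) + 1 / Real.pi) * (B + Cg) * P) * collisionFrequency y =
        m * (P * L - P / 4) * collisionFrequency y + 3 / 4 * m * (P ^ 2 / N) * collisionFrequency y +
          (S * m₂ * (1 / ν₀ + 1 / Real.pi) + 1 / Real.pi) * (B + Cg) * P * collisionFrequency y := by ring
    rw [e]
    linarith
  exact le_of_mul_le_mul_right htot hν

end Summit.AtomisticToContinuum.HydrodynamicLimit.Theorems.ClampedCorrectorBirth

end
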